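import Summits.QuantumFields.BalabanUV.T4Continuum.Spine.NE1p.DressedTowerWitnessSliceEnd
import Summits.QuantumFields.BalabanUV.T4Continuum.Spine.NE1p.DressedTransportAssembledUniformSliceWin

/-!
# T⁴ programme, spine estimate NE1′ (node O3b/H2) — row W7, part 3: the assembled slice-window BUNDLE of row S3h BY NAME on the
# W7 datum at every cutoff, and the root once more (formalisation crew `b2b-balaban-t4-ne1p-formalise-*`, leaf seat 03, generation 2;
# own-initiative consistency item, NOT a crew estimate row)

Cell `pub-balaban`, sub-cell `t4`, BINDER-OWNERS row NE1′ (owner lineage t4-ne1p-p1).  ADDITIVE — imports row W7 part 2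
`Spine/NE1p/DressedTowerWitnessSliceEnd` (p214558: the datum `towerM`, the ONE schedule `Wm`, the binder lemmas, row W5's ONE `UW`) and
leaf-09's row S3h part 1 `Spine/NE1p/DressedTransportAssembledUniformSliceWin` (p214557: `bookingLeaves_assembled_swin_of_schedule` — the
crew's per-cutoff bundle over the ASSEMBLED slice-window END with the K-free ratio) ONLY; modifies nothing.  One namespace with parts 1–2.

CONTENTS.  **`leavesM' K : BookingLeaves UW (BM K) (TM K) := bookingLeaves_assembled_swin_of_schedule Wm hratioM …`** — leaf-09's S3h
bundle with EVERY displayed binder discharged on the datum, at EVERY cutoff, over the SAME `UW` as rows W5 and W7 part 2 (the `hκ`∕`hC`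
proofs inside the constants differ only by proof irrelevance), `classAt_towerM'` (END-B's per-cutoff face read off these bundles) and
the root `DressedStability towerM` once more through `dressedStability_of_cell` over them (as an `example` — the statement is part 2's
landed `dressedStability_towerM`; the gate's dedup rule admits no second theorem with the same statement).  The analogue of row W5 part 2's `leavesW'`∕`dressedStability_towerW'` (S3g by name)
for the assembled face: S3h's hypothesis list is jointly satisfiable, uniformly in the cutoff, by K-free data.

HONEST FRAMING.  A decided toy: [folklore] kernel glue over parts 1–2, 0 sorry, 0 citations, no `def … : Prop` (the one `def` is a
`BookingLeaves`-valued TERM); NOTHING of Bałaban's densities asserted; action exponent `𝒜 ≡ 0` (declared in parts 1–2).  Headline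
(c4): «S3h's assembled slice-window bundle inhabited at every cutoff by one K-free `U` and one cutoff-free schedule — non-vacuity of
the SHAPES; NE1′ NOT proved; walls (w1)–(w7) unchanged».  Rung (B)+1 on ONE finite four-torus — NOT infinite volume, NOT a mass gap,
NOT OS on ℝ⁴, NOT Clay, NOT summit progress; spine PROVED 0∕9.  HONEST DEPENDENCY: continuum YM on T⁴ ⇐ BetaPertH ∧ nine spine
estimates (0/9 proved); BetaPertH ⇐ (D1) ∧ (D4) ∧ CAP+tail; G-an2-4 gates asym, D1 and NE2/3/4.
-/

noncomputable section

namespace Summit.QuantumFields.BalabanUV.T4Continuum.NE1p.DressedTowerWitnessSlice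

open MeasureTheory Set Metric Filter Finset
open scoped BigOperators
open Literature.MathematicalPhysics.QuantumFieldTheory.Balaban1983to89
open Literature.MathematicalPhysics.QuantumFieldTheory.Balaban1983to89.T4TermFormat
open Literature.MathematicalPhysics.QuantumFieldTheory.Balaban1983to89.T4TermFormat.Booking
open Literature.MathematicalPhysics.QuantumFieldTheory.Balaban1983to89.T4GatedBooking
open Literature.MathematicalPhysics.QuantumFieldTheory.Balaban1983to89.T4TrajectoryComparison
open T4TrajectoryModulus (bondBall bondBall_add_mem bondBall_latMove_add_mem bondBall_diam)
open T4BlockTransport (Fld NDir latMove latN Site norm_dir_le)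
open T4BirthChartTransport (GaugeInvariant BirthSlice RelGauge)
open T4TrajectoryDensity
open Summit.QuantumFields.BalabanUV.T4Continuum.T4TrajectoryDensityDressed
open Summit.QuantumFields.BalabanUV.T4Continuum.T4TrajectoryDensityWitness
open Summit.QuantumFields.BalabanUV.T4Continuum.NE1p.DressedRoot
open Summit.QuantumFields.BalabanUV.T4Continuum.NE1p.DressedUniformConstants
open Summit.QuantumFields.BalabanUV.T4Continuum.NE1p.DressedWindowScheduleWin
open Summit.QuantumFields.BalabanUV.T4Continuum.NE1p.DressedWindowScheduleModWin
open Summit.QuantumFields.BalabanUV.T4Continuum.NE1p.DressedTowerWitness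
open Summit.QuantumFields.BalabanUV.T4Continuum.NE1p.DressedTransportAssembledModData
open Summit.QuantumFields.BalabanUV.T4Continuum.NE1p.DressedTransportAssembledUniformSliceWin

/-- **ROW S3h's ASSEMBLED SLICE-WINDOW BUNDLE BY NAME ON THE DATUM, AT EVERY CUTOFF** — leaf-09's
`bookingLeaves_assembled_swin_of_schedule Wm hratioM …` with every displayed binder discharged by parts 1–2's lemmas, over row W5's
ONE `UW`. [folklore] -/
def leavesM' (K : ℕ) : BookingLeaves UW (BM K) (TM K) :=
  bookingLeaves_assembled_swin_of_schedule Wm (T := TM K) (Fn := fun _ k' k => FnM K k' k)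
    (rel := fun _ _ _ U U' => U = U') (ref := fun _ _ U => U) (base := fun _ _ => base₁) (𝒜 := fun _ _ => zeroExp)
    (𝒬 := fun _ k => 𝒬M K k) (q := fun _ _ _ => 0) (μ := fun _ k => flAt (atomW (k + 1))) (z₀ := fun _ _ => 0)
    (z₁ := fun _ _ => 0) (defect := fun _ _ k => defW (k + 1)) (m := 1 / 4) (s := fun _ _ => 0) (s1 := s1M K)
    (Asz := AszM K) (S := fun _ b => {b}) (Sg := fun _ b => {(b, 0)}) (c := fun _ _ => (((1 / 4 : ℝ)) : ℂ))
    (δf := fun _ k _ => dfW k)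
    hratioM one_le_LW le_rfl zero_le_one zero_le_one (by norm_num) (locCell_LW _).le (by norm_num) (by norm_num) one_pos
    (by norm_num) (fun b k' _ _ _ => birthSlice_anti_window (hslM K b k') (Wm.hwcw k'))
    (fun _ k' k _ _ _ _ U => FnM_succ K k' k U) (fun _ _ k _ _ _ _ _ => mem_bddClass_flAt _ _)
    (fun _ _ k _ _ _ _ => realBaseAt_W _ _) (fun _ _ k _ _ _ _ => exponentSliceAt_M _ _ _ _) (fun b k => hQM K b k)
    (hSgM K) (fun _ _ => rfl) (fun f k'' => aszRec_birth (TM K).gen (fun _ _ => 0) (s1M K) f k'')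
    (fun f _ _ _ hk => aszRec_succ (TM K).gen (fun _ _ => 0) (s1M K) f hk) (fun _ _ => hcmM)
    (fun b k p hp => hδfM K k b p hp) (fun _ k _ _ => hδfwkM k) (fun _ k => hDμM k) (fun _ k => hz₁M k)
    (fun _ _ k _ _ _ _ U₀ _ pd _ _ => (relGauge_pairs k).mono fun z hz t _ => hz (latMove U₀ pd t))
    (fun _ _ _ _ _ h => h ▸ rfl) (fun _ _ _ k _ => aesm_flAt _ _) (fun _ _ k => hdefwkM k)
    (fun _ k' k _ _ _ => hrateM k' k) (fun b k' k _ _ _ _ ε hε => hlinM K b k' k ε hε) (fun _ => le_rfl) (fun _ _ => le_rfl)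
    (hregM K _) (fun _ _ => by norm_num) (fun k _ _ _ => Nat.zero_le k) (hcountM K) (hbirthM K)

/-- **END-B's PER-CUTOFF FACE THROUGH ROW S3h's BUNDLE**: the class AND every dressed budget gate along the trajectory, at every
cutoff, read off `leavesM'`. [folklore] -/
theorem classAt_towerM' (K : ℕ) :
    ClassAt (BM K) UW.A₀ UW.ρ₁ UW.τ ∧ ∀ k, k ≤ (BM K).K → RanBelow (budgetGate (TM K) (leavesM' K).s₀ UW.m (leavesM' K).S UW.C
      (leavesM' K).ρ) k :=
  classAt_of_bookingLeaves (leavesM' K)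

/-- THE ROOT THROUGH ROW S3h's BUNDLES — the same tower, the same ONE `U`, S3h's bundle at every cutoff, END-B by
`dressedStability_of_cell`.  (An `example`, not a theorem: the statement `DressedStability towerM` is already the landed
`dressedStability_towerM` of part 2 — the gate's dedup rule; this is the second ROUTE to it.) [folklore] -/
example : DressedStability towerM :=
  dressedStability_of_cell towerM one_le_LW (by norm_num) le_rfl (by norm_num : (0 : ℝ) ≤ 1 / 2) zero_le_one zero_le_one
    (by norm_num) (locCell_LW _).le (by norm_num) (by norm_num) fun _ K => leavesM' K

end Summit.QuantumFields.BalabanUV.T4Continuum.NE1p.DressedTowerWitnessSlice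

end
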